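import Summits.CriticalPhenomena.Ising3DConformalLimit.Theorems.PrecisionLaplacianDirectCorrelationStableTailSlabModeExpDecayDiagLineHolAux7
import Summits.CriticalPhenomena.Ising3DConformalLimit.Theorems.PrecisionLaplacianDirectCorrelationStableTailSlabModeExpDecayDiagLineHolAux2

/-!
# Diagonal line holomorphy, auxiliary file 8: the UNIFIED diagonal moment property of the critical
# two-point function (even AND odd diagonal layers)

Helper file for the sub-stub `stub_slabModeExpDecay_auxDiagLineHol` (brick of `stub_slabModeExpDecay`)
of line `self-energy-pick-inversion`, crux `PrecisionLaplacian.DirectCorrelationStableTail`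
(stmt-CriticalPhenomena-4799). Pure theorem file.

**Theorem** (`diagUnified_hausdorff`, registered sub-goal `stub_slabModeExpDecay_auxDiagLineHol9`).
For every finite `s ⊂ ℤ²` (parametrising the diagonal plane by `a ↦ x_a = (a₀, -a₀, a₁)`) and
`c : ℤ² → ℝ` there is a finite POSITIVE measure `ν` on `[-1, 1]` with, for all `n : ℕ`,
`∑ c_a c_b G(x_a - x_b + n(e₀+e₁)) = ∫ x^{2n} dν` (even layers) and
`∑ c_a c_b G(e₀ + n(e₀+e₁) - x_a - x_b) = ∫ x^{2n+1} dν` (odd layers, REFLECTED second point),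
`G = criticalTwoPoint 3`. This extends the even-layer statement `stub_slabModeExpDecay_auxDiagHausdorff`:
`ν` is the spectral measure of the in-plane observable `∑ c_a σ_{x_a}` for the symmetric ONE-STEP
diagonal transfer matrix `T` of file 7 (real symmetric, `T² =` the positive two-step matrix, so the
spectrum is real and two-sided); the reflection of the second point on odd layers is the twist that
makes the one-step chain homogeneous.

Proof: on the rotated torus (`N ≥ 3`) the unified forms are `Z⁻¹ Tr(diag F T^m diag F T^{2N-m})`
(file 7), i.e. moments of a finitely supported positive measure on `ℝ` for `m < 2N`; the even
moments are `≤ (∑|c_a|)²`; `N → ∞` with `m*(β_c) = 0` (`tendsto_rotTwoPoint_proj_of_magnetization_eq_zero`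
of file `…DiagHausdorff`) and the moment criterion on `[-1, 1]` (file 2).
-/

noncomputable section

namespace Summit.CriticalPhenomena.Ising3DConformalLimit.Cruxes.DirectCorrelationStableTail.SelfEnergyPickInversion

open MeasureTheory Filter Topology Set Matrix
open scoped BigOperators
open Literature.Probability.LatticeModels

/-! ### The unified forms on the rotated torus -/

section Torus

variable {d'' N : ℕ} [NeZero N]

/-- **The unified diagonal forms of the rotated torus are two-insertion traces of the one-step matrix.**
For `N ≥ 3`, coefficients `c_a` at sites `(0, w_a)` of the even layer `0`, the layer observable
`F = ∑_a c_a σ_{w_a}` and `m ∈ ℤ/2Nℤ`: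
`Z · ∑_{a,b} c_a c_b ⟨σ_{(0,w_a)} σ_{X_m(w_b)}⟩^{rot} = Tr(diag F · T^m · diag F · T^{2N-m})`, where the second
site is `(2n, w + s_n)` for `m = 2n` and `(2n+1, -w + s_n)` for `m = 2n + 1`. [folklore] -/
theorem Z_mul_rotUnifiedForm_eq_trace (hN : 3 ≤ N) (β : ℝ) {ι : Type*} [Fintype ι]
    (c : ι → ℝ) (w : ι → TorusSite (d'' + 1) N) (m : ZMod (2 * N)) :
    isingPartitionFunction (rotGraph d'' N) Finset.univ β 0 .free *
        ∑ a, ∑ b, c a * c b * rotTwoPoint d'' N β ((0 : ZMod (2 * N)), w a)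
          (if (parityEquiv m).2 = 0 then (twoMul (parityEquiv m).1, w b + layerShift (parityEquiv m).1)
            else (twoMul (parityEquiv m).1 + 1, -(w b) + layerShift (parityEquiv m).1)) =
      (diagonal (fun R : Layer (d'' + 1) N => ∑ a, c a * spinAt (w a) R) *
        (Matrix.of fun R S : Layer (d'' + 1) N => diagHalfWeight β 0 R * diagK β R (fun w => S (-w)) *
          diagHalfWeight β 0 S) ^ m.val *
        diagonal (fun R : Layer (d'' + 1) N => ∑ a, c a * spinAt (w a) R) *
        (Matrix.of fun R S : Layer (d'' + 1) N => diagHalfWeight β 0 R * diagK β R (fun w => S (-w)) *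
          diagHalfWeight β 0 S) ^ (2 * N - m.val)).trace := by
  -- adapted from `Z_mul_rotDiagForm_eq_trace` (file `…DiagHausdorff`)
  classical
  set F : Layer (d'' + 1) N → ℝ := fun R => ∑ a, c a * spinAt (w a) R with hF
  set site : TorusSite (d'' + 1) N → RotSite d'' N := fun v =>
    if (parityEquiv m).2 = 0 then (twoMul (parityEquiv m).1, v + layerShift (parityEquiv m).1)
      else (twoMul (parityEquiv m).1 + 1, -v + layerShift (parityEquiv m).1) with hsite
  rw [← sum_exp_mul_mul_eq_trace_oneStep hN β 0 F F m]
  have hlayer0 : ∀ σ : SpinConfig (RotSite d'' N),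
      F (evenLayer σ 0) = ∑ a, c a * spinAt ((0 : ZMod (2 * N)), w a) σ := by
    intro σ
    simp only [hF]
    refine Finset.sum_congr rfl fun a _ => ?_
    rw [← spinAt_even σ 0 (w a)]
    simp only [twoMul_zero, layerShift_zero, add_zero]
  have hlayerm : ∀ σ : SpinConfig (RotSite d'' N),
      (if (parityEquiv m).2 = 0 then F (evenLayer σ (parityEquiv m).1)
        else F (fun v => oddLayer σ (parityEquiv m).1 (-v))) = ∑ b, c b * spinAt (site (w b)) σ := by
    intro σ
    simp only [hF, hsite]
    split_ifs with hpar
    · refine Finset.sum_congr rfl fun b _ => ?_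
      rw [← spinAt_even σ _ (w b)]
    · refine Finset.sum_congr rfl fun b _ => ?_
      rw [spinAt_comp_neg, ← spinAt_odd σ _ (-(w b))]
  simp_rw [hlayer0, hlayerm]
  have hR : ∑ σ, rotWeight β 0 σ * ((∑ a, c a * spinAt ((0 : ZMod (2 * N)), w a) σ) *
      ∑ b, c b * spinAt (site (w b)) σ) =
      ∑ a, ∑ b, c a * c b * ∑ σ, rotWeight β 0 σ *
        (spinAt ((0 : ZMod (2 * N)), w a) σ * spinAt (site (w b)) σ) := by
    calc ∑ σ, rotWeight β 0 σ * ((∑ a, c a * spinAt ((0 : ZMod (2 * N)), w a) σ) *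
          ∑ b, c b * spinAt (site (w b)) σ)
        = ∑ σ, ∑ a, ∑ b, c a * c b * (rotWeight β 0 σ *
            (spinAt ((0 : ZMod (2 * N)), w a) σ * spinAt (site (w b)) σ)) := by
          refine Finset.sum_congr rfl fun σ _ => ?_
          rw [Finset.sum_mul_sum, Finset.mul_sum]
          refine Finset.sum_congr rfl fun a _ => ?_
          rw [Finset.mul_sum]
          refine Finset.sum_congr rfl fun b _ => ?_
          ring
      _ = ∑ a, ∑ σ, ∑ b, c a * c b * (rotWeight β 0 σ *
            (spinAt ((0 : ZMod (2 * N)), w a) σ * spinAt (site (w b)) σ)) := by rw [Finset.sum_comm]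
      _ = ∑ a, ∑ b, ∑ σ, c a * c b * (rotWeight β 0 σ *
            (spinAt ((0 : ZMod (2 * N)), w a) σ * spinAt (site (w b)) σ)) := by
          refine Finset.sum_congr rfl fun a _ => ?_
          rw [Finset.sum_comm]
      _ = _ := by
          refine Finset.sum_congr rfl fun a _ => Finset.sum_congr rfl fun b _ => ?_
          rw [Finset.mul_sum]
  have hL : isingPartitionFunction (rotGraph d'' N) Finset.univ β 0 .free *
        ∑ a, ∑ b, c a * c b * rotTwoPoint d'' N β ((0 : ZMod (2 * N)), w a) (site (w b)) =
      ∑ a, ∑ b, c a * c b * ∑ σ, rotWeight β 0 σ *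
        (spinAt ((0 : ZMod (2 * N)), w a) σ * spinAt (site (w b)) σ) := by
    rw [Finset.mul_sum]
    refine Finset.sum_congr rfl fun a _ => ?_
    rw [Finset.mul_sum]
    refine Finset.sum_congr rfl fun b _ => ?_
    rw [← Z_mul_rotTwoPoint_eq_sum]
    ring
  rw [hL, ← hR]
  rfl

/-- **Finite-volume unified moments**: on the rotated torus, `N ≥ 3`, the unified diagonal forms of a
layer observable are the moments of order `< 2N` of a finitely supported POSITIVE measure on `ℝ`:
`∫ x^{2n} dν = ∑ c_a c_b ⟨σ_{(0,w_a)} σ_{(2n, w_b + s_n)}⟩` and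
`∫ x^{2n+1} dν = ∑ c_a c_b ⟨σ_{(0,w_a)} σ_{(2n+1, -w_b + s_n)}⟩` for `n < N`. [folklore] -/
theorem exists_rotUnifiedForm_moments (hN : 3 ≤ N) (β : ℝ) {ι : Type*} [Fintype ι]
    (c : ι → ℝ) (w : ι → TorusSite (d'' + 1) N) :
    ∃ ν : Measure ℝ, IsFiniteMeasure ν ∧ (∀ g : ℝ → ℝ, Integrable g ν) ∧
      ∀ n : ℕ, n < N →
        (∫ t, t ^ (2 * n) ∂ν = ∑ a, ∑ b, c a * c b *
          rotTwoPoint d'' N β ((0 : ZMod (2 * N)), w a) (twoMul (n : ZMod N), w b + layerShift (n : ZMod N))) ∧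
        (∫ t, t ^ (2 * n + 1) ∂ν = ∑ a, ∑ b, c a * c b *
          rotTwoPoint d'' N β ((0 : ZMod (2 * N)), w a) (twoMul (n : ZMod N) + 1, -(w b) + layerShift (n : ZMod N))) := by
  classical
  haveI : NeZero (2 * N) := ⟨by have := NeZero.ne N; omega⟩
  haveI : Fact (1 < 2 * N) := ⟨by omega⟩
  set Z := isingPartitionFunction (rotGraph d'' N) Finset.univ β 0 .free with hZ
  have hZpos : 0 < Z := isingPartitionFunction_pos _ _ β 0 _
  obtain ⟨ev, cc, hcc, -, hspec⟩ := trace_diag_pow_diag_pow_eq_sum_of_isHermitian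
    (oneStep_isHermitian (d'' := d'') (N := N) β 0) (fun R : Layer (d'' + 1) N => ∑ a, c a * spinAt (w a) R)
  obtain ⟨ν, hfin, hint, hmom⟩ := exists_atomicMeasure_of_spectralSum_real cc ev hcc hZpos
    (M := 2 * N) (even_two_mul N) (by have := NeZero.ne N; omega)
  refine ⟨ν, hfin, hint, fun n hn => ?_⟩
  -- the time indices `2n` and `2n + 1` in `ℤ/2Nℤ`
  have hval_even : (twoMul (n : ZMod N) : ZMod (2 * N)).val = 2 * n := by
    rw [twoMul, ZMod.val_natCast, ZMod.val_natCast, Nat.mod_eq_of_lt hn, Nat.mod_eq_of_lt (by omega)]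
  have hval_odd : (twoMul (n : ZMod N) + 1 : ZMod (2 * N)).val = 2 * n + 1 := by
    rw [ZMod.val_add_of_lt, hval_even, ZMod.val_one]
    rw [hval_even, ZMod.val_one]; omega
  have hpe_even : parityEquiv (twoMul (n : ZMod N) : ZMod (2 * N)) = ((n : ZMod N), 0) := parityEquiv_twoMul _
  have hpe_odd : parityEquiv (twoMul (n : ZMod N) + 1 : ZMod (2 * N)) = ((n : ZMod N), 1) :=
    parityEquiv_twoMul_add_one _
  constructor
  · have hrep := Z_mul_rotUnifiedForm_eq_trace hN β c w (twoMul (n : ZMod N))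
    simp only [hpe_even, Fin.isValue, ↓reduceIte, hval_even] at hrep
    rw [hmom (2 * n) (by omega), ← hspec (2 * n) (2 * N - 2 * n), ← hrep, ← hZ, ← mul_assoc,
      inv_mul_cancel₀ hZpos.ne', one_mul]
  · have hrep := Z_mul_rotUnifiedForm_eq_trace hN β c w (twoMul (n : ZMod N) + 1)
    simp only [hpe_odd, Fin.isValue, one_ne_zero, ↓reduceIte, hval_odd] at hrep
    rw [hmom (2 * n + 1) (by omega), ← hspec (2 * n + 1) (2 * N - (2 * n + 1)), ← hrep, ← hZ, ← mul_assoc,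
      inv_mul_cancel₀ hZpos.ne', one_mul]

end Torus

/-! ### The lattice: odd-layer sites of `ℤ³` on the rotated torus, and the limit `N → ∞` -/

/-- **The reflected odd-layer site**: for `x_b = (b₀, -b₀, b₁)` and `y = (n + 1 - b₀, n + b₀, -b₁)`
(`= e₀ + n(e₀+e₁) - x_b` reflected in the plane), `π(y) = (2n + 1, -π(x_b)₂ + n e_b)`. [folklore] -/
theorem rotProj_oddSite {N : ℕ} [NeZero N] (n : ℕ) (b : Fin 2 → ℤ) :
    rotProj 1 N (![(n : ℤ) + 1 - b 0, n + b 0, -(b 1)] : Site 3) =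
      (twoMul ((n : ℕ) : ZMod N) + 1, -(rotProj 1 N (![b 0, -(b 0), b 1] : Site 3)).2 + layerShift ((n : ℕ) : ZMod N)) := by
  refine Prod.ext ?_ ?_
  · rw [rotProj_apply_fst]
    simp only [twoMul, ZMod.val_natCast, Matrix.cons_val_zero, Matrix.cons_val_one]
    have h2 : ((2 * (n % N) : ℕ) : ZMod (2 * N)) = ((2 * n : ℕ) : ZMod (2 * N)) := by
      rw [ZMod.natCast_eq_natCast_iff', two_mul_mod_two_mul, two_mul_mod_two_mul, Nat.mod_mod]
    rw [h2]
    push_cast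
    ring
  · funext j
    rw [rotProj_apply_snd]
    simp only [Pi.add_apply, Pi.neg_apply, rotProj_apply_snd, layerShift]
    fin_cases j
    · simp; ring
    · simp

/-- The displacement to the reflected odd-layer site. [folklore] -/
theorem oddSite_sub (n : ℤ) (a b : Fin 2 → ℤ) :
    (![n + 1 - b 0, n + b 0, -(b 1)] : Site 3) - ![a 0, -(a 0), a 1] = ![n + 1 - a 0 - b 0, n + a 0 + b 0, -(a 1) - b 1] := by
  funext j
  fin_cases j <;> simp
  all_goals ring

/-- **The rotated-torus odd unified form converges** (`m*(β) = 0`, along `N_j = j + 3`). [folklore] -/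
theorem tendsto_rotOddForm {β : ℝ} (hβ : 0 ≤ β) (hm : spontaneousMagnetization (1 + 2) β = 0)
    {ι : Type*} [Fintype ι] (c : ι → ℝ) (p : ι → Fin 2 → ℤ) (n : ℕ) :
    Tendsto (fun j : ℕ => ∑ a, ∑ b, c a * c b *
        rotTwoPoint 1 (j + 3) β ((0 : ZMod (2 * (j + 3))), (rotProj 1 (j + 3) (![p a 0, -(p a 0), p a 1] : Site 3)).2)
          (twoMul ((n : ℕ) : ZMod (j + 3)) + 1, -(rotProj 1 (j + 3) (![p b 0, -(p b 0), p b 1] : Site 3)).2 +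
            layerShift ((n : ℕ) : ZMod (j + 3))))
      atTop (𝓝 (∑ a, ∑ b, c a * c b *
        twoPointPlus (1 + 2) β (![(n : ℤ) + 1 - p a 0 - p b 0, n + p a 0 + p b 0, -(p a 1) - p b 1] : Site 3))) := by
  -- adapted from `tendsto_rotDiagForm` (file `…DiagHausdorff`)
  classical
  refine tendsto_finsetSum _ fun a _ => tendsto_finsetSum _ fun b _ => ?_
  refine Tendsto.const_mul _ ?_
  have hN : Tendsto (fun j : ℕ => j + 3) atTop atTop := tendsto_add_atTop_nat 3
  have key := tendsto_rotTwoPoint_proj_of_magnetization_eq_zero (d'' := 1) (Nseq := fun j => j + 3) hβ hm hN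
    (![(n : ℤ) + 1 - p a 0 - p b 0, n + p a 0 + p b 0, -(p a 1) - p b 1] : Site 3)
  refine key.congr fun j => ?_
  rw [← oddSite_sub, map_sub, rotProj_oddSite, ← rotProj_eq_of_add_eq_zero (![p a 0, -(p a 0), p a 1] : Site 3)
    (by simp), rotTwoPoint_eq_zero_sub β (rotProj 1 (j + 3) (![p a 0, -(p a 0), p a 1] : Site 3))]

/-- **The unified diagonal moment property in infinite volume** (`β ≥ 0`, `m*(β) = 0`): for
coefficients `c_a` at points `x_a = (a₀, -a₀, a₁)` of the diagonal plane there is a finite positive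
measure `ν` on `[-1, 1]` with `∑ c_a c_b ⟨σ₀ σ_{x_b - x_a + n(e₀+e₁)}⟩⁺ = ∫ x^{2n} dν` and
`∑ c_a c_b ⟨σ₀ σ_{(n+1-a₀-b₀, n+a₀+b₀, -a₁-b₁)}⟩⁺ = ∫ x^{2n+1} dν` for all `n`. [folklore] -/
theorem exists_diagUnified_measure {β : ℝ} (hβ : 0 ≤ β) (hm : spontaneousMagnetization (1 + 2) β = 0)
    {ι : Type*} [Fintype ι] (c : ι → ℝ) (p : ι → Fin 2 → ℤ) :
    ∃ ν : Measure ℝ, IsFiniteMeasure ν ∧ ν (Set.Icc (-1 : ℝ) 1)ᶜ = 0 ∧ ∀ n : ℕ,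
      (∑ a, ∑ b, c a * c b * twoPointPlus (1 + 2) β ((![p b 0, -(p b 0), p b 1] : Site 3) - ![p a 0, -(p a 0), p a 1] +
        (Pi.single 0 (n : ℤ) + Pi.single 1 (n : ℤ))) = ∫ x, x ^ (2 * n) ∂ν) ∧
      (∑ a, ∑ b, c a * c b * twoPointPlus (1 + 2) β
        (![(n : ℤ) + 1 - p a 0 - p b 0, n + p a 0 + p b 0, -(p a 1) - p b 1] : Site 3) = ∫ x, x ^ (2 * n + 1) ∂ν) := by
  classical
  set x : ι → Site 3 := fun a => ![p a 0, -(p a 0), p a 1] with hx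
  have hx0 : ∀ a, x a 0 + x a 1 = 0 := fun a => by simp [hx]
  have hex : ∀ j : ℕ, ∃ ν : Measure ℝ, IsFiniteMeasure ν ∧ (∀ g : ℝ → ℝ, Integrable g ν) ∧
      ∀ n : ℕ, n < j + 3 →
        (∫ t, t ^ (2 * n) ∂ν = ∑ a, ∑ b, c a * c b *
          rotTwoPoint 1 (j + 3) β ((0 : ZMod (2 * (j + 3))), (rotProj 1 (j + 3) (x a)).2)
            (twoMul ((n : ℕ) : ZMod (j + 3)), (rotProj 1 (j + 3) (x b)).2 + layerShift ((n : ℕ) : ZMod (j + 3)))) ∧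
        (∫ t, t ^ (2 * n + 1) ∂ν = ∑ a, ∑ b, c a * c b *
          rotTwoPoint 1 (j + 3) β ((0 : ZMod (2 * (j + 3))), (rotProj 1 (j + 3) (x a)).2)
            (twoMul ((n : ℕ) : ZMod (j + 3)) + 1, -(rotProj 1 (j + 3) (x b)).2 + layerShift ((n : ℕ) : ZMod (j + 3)))) :=
    fun j => exists_rotUnifiedForm_moments (N := j + 3) (by omega) β c _
  choose ν hfin hint hmom using hex
  -- the limits of the moments
  set E : ℕ → ℝ := fun n => ∑ a, ∑ b, c a * c b * twoPointPlus (1 + 2) β (x b - x a +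
      (Pi.single 0 (n : ℤ) + Pi.single 1 (n : ℤ))) with hE
  set O : ℕ → ℝ := fun n => ∑ a, ∑ b, c a * c b * twoPointPlus (1 + 2) β
      (![(n : ℤ) + 1 - p a 0 - p b 0, n + p a 0 + p b 0, -(p a 1) - p b 1] : Site 3) with hO
  set u : ℕ → ℝ := fun m => if m % 2 = 0 then E (m / 2) else O (m / 2) with hu
  have hu_even : ∀ n, u (2 * n) = E n := fun n => by
    simp only [hu, Nat.mul_mod_right, ↓reduceIte, Nat.mul_div_cancel_left n two_pos]
  have hu_odd : ∀ n, u (2 * n + 1) = O n := fun n => by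
    have h2 : (2 * n + 1) / 2 = n := by omega
    have h3 : (2 * n + 1) % 2 = 1 := by omega
    simp only [hu, h3, one_ne_zero, ↓reduceIte, h2]
  have hshift : ∀ (j : ℕ) (n : ℕ) (v : TorusSite (1 + 1) (j + 3)),
      (((0 : ZMod (2 * (j + 3))), v) + evenShift ((n : ℕ) : ZMod (j + 3)) : RotSite 1 (j + 3)) =
        (twoMul ((n : ℕ) : ZMod (j + 3)), v + layerShift ((n : ℕ) : ZMod (j + 3))) := by
    intro j n v; rw [evenShift, Prod.mk_add_mk, zero_add]
  have hlim : ∀ m, Tendsto (fun j => ∫ t, t ^ m ∂(ν j)) atTop (𝓝 (u m)) := by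
    intro m
    obtain ⟨n, rfl | rfl⟩ := Nat.even_or_odd' m
    · have h1 := tendsto_rotDiagForm (d'' := 1) hβ hm c x hx0 n
      rw [hu_even]
      refine h1.congr' ?_
      rw [EventuallyEq, eventually_atTop]
      refine ⟨n, fun j hj => ?_⟩
      rw [(hmom j n (by omega)).1]
      simp only [hshift]
    · have h1 := tendsto_rotOddForm hβ hm c p n
      rw [hu_odd]
      refine h1.congr' ?_
      rw [EventuallyEq, eventually_atTop]
      exact ⟨n, fun j hj => ((hmom j n (by omega)).2).symm⟩
  -- even moments are bounded
  have hle : ∀ j n, n ≤ j → ∫ t, t ^ (2 * n) ∂(ν j) ≤ (∑ a, |c a|) ^ 2 := by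
    intro j n hnj
    rw [(hmom j n (by omega)).1]
    exact sum_mul_mul_rotTwoPoint_le hβ c _ _
  obtain ⟨μ, hμfin, hμ0, hμmom⟩ := exists_measure_Icc_neg_one_of_momentLimit u ν hfin
    (fun j m => hint j _) hle hlim
  refine ⟨μ, hμfin, hμ0, fun n => ⟨?_, ?_⟩⟩
  · rw [← hμmom (2 * n), hu_even]
  · rw [← hμmom (2 * n + 1), hu_odd]

/-- **The unified diagonal moment property of the critical two-point function of the 3D Ising model**
(see the module docstring): for finitely supported coefficients on the diagonal plane, the even and
odd diagonal-layer forms are the even and odd moments of ONE finite positive measure on `[-1, 1]`.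
[folklore] -/
theorem diagUnified_hausdorff (s : Finset (Fin 2 → ℤ)) (c : (Fin 2 → ℤ) → ℝ) :
    ∃ ν : Measure ℝ, IsFiniteMeasure ν ∧ ν (Set.Icc (-1 : ℝ) 1)ᶜ = 0 ∧ ∀ n : ℕ,
      (∑ a ∈ s, ∑ b ∈ s, c a * c b * criticalTwoPoint 3 ![(a 0 - b 0) + n, -(a 0 - b 0) + n, a 1 - b 1] =
        ∫ x, x ^ (2 * n) ∂ν) ∧
      (∑ a ∈ s, ∑ b ∈ s, c a * c b * criticalTwoPoint 3 ![(n : ℤ) + 1 - a 0 - b 0, n + a 0 + b 0, -(a 1) - b 1] =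
        ∫ x, x ^ (2 * n + 1) ∂ν) := by
  classical
  have hβ : (0 : ℝ) ≤ criticalBeta 3 := criticalBeta_nonneg 3
  have hm : spontaneousMagnetization (1 + 2) (criticalBeta (1 + 2)) = 0 :=
    spontaneousMagnetization_criticalBeta_eq_zero_holds (d := 1 + 2) (by norm_num)
  obtain ⟨ν, hνfin, hν0, hν⟩ := exists_diagUnified_measure (β := criticalBeta (1 + 2)) hβ hm
    (fun a : s => c a) (fun a : s => (a : Fin 2 → ℤ))
  refine ⟨ν, hνfin, hν0, fun n => ⟨?_, ?_⟩⟩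
  · rw [← (hν n).1, Finset.sum_comm, ← Finset.sum_coe_sort s]
    refine Finset.sum_congr rfl fun a _ => ?_
    rw [← Finset.sum_coe_sort s]
    refine Finset.sum_congr rfl fun b _ => ?_
    rw [diagSite_sub_add_single, mul_comm (c b) (c a)]
    rfl
  · rw [← (hν n).2, ← Finset.sum_coe_sort s]
    refine Finset.sum_congr rfl fun a _ => ?_
    rw [← Finset.sum_coe_sort s]
    rfl

/-- **Registered auxiliary stub `stub_slabModeExpDecay_auxDiagLineHol9`** (sub-goal of the brick
`stub_slabModeExpDecay_auxDiagLineHol` of `stub_slabModeExpDecay`): the unified (even and odd layers)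
diagonal moment property of `criticalTwoPoint 3` (`diagUnified_hausdorff`). [folklore] -/
theorem stub_slabModeExpDecay_auxDiagLineHol9 : ∀ (s : Finset (Fin 2 → ℤ)) (c : (Fin 2 → ℤ) → ℝ), ∃ ν : MeasureTheory.Measure ℝ, MeasureTheory.IsFiniteMeasure ν ∧ ν (Set.Icc (-1 : ℝ) 1)ᶜ = 0 ∧ ∀ n : ℕ, (∑ a ∈ s, ∑ b ∈ s, c a * c b * criticalTwoPoint 3 ![(a 0 - b 0) + n, -(a 0 - b 0) + n, a 1 - b 1] = ∫ x, x ^ (2 * n) ∂ν) ∧ (∑ a ∈ s, ∑ b ∈ s, c a * c b * criticalTwoPoint 3 ![(n : ℤ) + 1 - a 0 - b 0, n + a 0 + b 0, -(a 1) - b 1] = ∫ x, x ^ (2 * n + 1) ∂ν) :=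
  fun s c => diagUnified_hausdorff s c

end Summit.CriticalPhenomena.Ising3DConformalLimit.Cruxes.DirectCorrelationStableTail.SelfEnergyPickInversion

end
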